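import Mathlib
import Summits.NavierStokesRegularity.NavierStokesRegularity.Theorems.EulerZoomLiouvillePowerGaugeEulerLiouvilleWeakEtaRenormalisation
import Summits.NavierStokesRegularity.NavierStokesRegularity.Theorems.EulerZoomLiouvillePowerGaugeEulerLiouvilleWeakRenormalizedTransportTools
import Literature.Analysis.FluidPDE.SteadyEulerVelocityTesting
import Literature.Analysis.FunctionSpaces.DiPernaLionsCommutator
import HarnessLib

/-!
# Crux `EulerZoomLiouville.PowerGaugeEulerLiouville` (stmt-NavierStokesRegularity-19832), weak stratum, line `weak_axisym` (X1b):
# `stub_etaRenormalisation` CLOSED MODULO THE DIPERNA–LIONS COMMUTATOR LEMMA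

Route №10 `EulerZoomLiouville` (NavierStokesRegularity), crux E = stmt-NavierStokesRegularity-19832; width seat ns-ezl-w1 g9 under the LEAD ns-typeII-p2.
The line's stub X1b (`Sig.stub_etaRenormalisation`: the Casimir `η ∈ L²_loc` of the Ukhovskii–Yudovich weak stratum, a distributional solution of
`div(Wη) = (2γ−1)η` with `W = γy + V ∈ W^{1,2}_loc`, `div W = 3γ`, is a RENORMALISED solution) is the DiPerna–Lions renormalisation theorem (1989, Thm. II.1),
scalar case `p = p′ = 2`.  Everything except the COMMUTATOR LEMMA (DiPerna–Lions 1989, Lemma II.1) is proved in the tree (`…WeakEtaMollified`, `…WeakEtaApprox`,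
`…WeakEtaRenormalisedMollified`, `…WeakEtaRenormalisation`); this file states the commutator lemma in its `L²–W^{1,2}` local form on `ℝ³` as a NAMED FACT
(published result, cited) and derives the member CONDITIONALLY on it:

* `Literature.Analysis.FunctionSpaces.DiPernaLionsCommutatorL2` (Literature, cited, NOT proved here) — the named fact: for `W ∈ W^{1,2}_loc(ℝ³;ℝ³)` (weak gradient `DW`), `η ∈ L²_loc`, and a bump sequence `φ̃ₙ` with `r_φₙ → 0`,
  the commutator `sₙ = (W·∇)(φ̃ₙ ⋆ η) − φ̃ₙ ⋆ ((W·∇)η)` — unpacked with `(W·∇)η := div(Wη) − η tr DW` as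
  `sₙ(x) = ∫ η(y) Dφ̃ₙ(x−y)[W x − W y] dy + (φ̃ₙ ⋆ (η tr DW))(x)` — tends to `0` in `L¹(B_R)` for every `R`, for fixed-shape bumps (`rOut = 2 rIn`);
* `isWeaklyDivFree_of_transportDivergence` — `div W = 3γ` in `𝒟′` for `W = γy + V` ⇒ `V` weakly divergence free (`∫ Dθ[y] = −3∫θ`);
* `commutator_limit_of_DL` — under the fact: `∫⁻_{B_R} ‖rₙ + 3γη‖ₑ → 0` (`tr DW = 3γ` a.e., `φ̃ₙ ⋆ (3γη) = 3γηₙ → 3γη` in `L¹_loc`);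
* `etaRenormalisation` — **`Sig.stub_etaRenormalisation` δ-unfolded (η generalised), CONDITIONAL on `DiPernaLionsCommutatorL2`**
  (fill, once the fact is a hypothesis of the stub or discharged: `intro ρ hρ hρh V G hG hdiv hη2 hθ; exact WeakAxisym.etaRenormalisation hDL hρ hρh hG hdiv hη2 hθ`).
[folklore; DiPernaLions1989Invent Lemma II.1 and Thm. II.1]

WHAT THIS IS NOT: not NS, not E; X1b is closed MODULO a cited fact (conditional result), the fact itself is NOT proved here; 19832 is OPEN.
-/

noncomputable section

-- flat `Theorems/<Route><Decl>…` files of one crux share the namespace of the crux (tree convention)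
set_option linter.dupNamespace false

open MeasureTheory Set Filter Topology Metric Function TopologicalSpace ContinuousLinearMap
open scoped ENNReal NNReal RealInnerProductSpace ContDiff Convolution

namespace Summit.NavierStokesRegularity.NavierStokesRegularity.Theorems.PowerGaugeEulerLiouville.WeakAxisym

open Literature.Analysis Literature.Analysis.FunctionSpaces Literature.Analysis.FluidPDE
open Summit.NavierStokesRegularity.NavierStokesRegularity.Theorems.PowerGaugeEulerLiouville

variable {V : EuclideanSpace ℝ (Fin 3) → EuclideanSpace ℝ (Fin 3)} {G : EuclideanSpace ℝ (Fin 3) → EuclideanSpace ℝ (Fin 3) →L[ℝ] EuclideanSpace ℝ (Fin 3)}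
  {η : EuclideanSpace ℝ (Fin 3) → ℝ} {γ : ℝ}

/-- `div W = 3γ` in `𝒟′` for `W = γ(y − 0) + V` (`V ∈ L¹_loc`) ⇒ `V` is weakly divergence free (`∫ Dθ[y] = −3∫θ`). [folklore] -/
theorem isWeaklyDivFree_of_transportDivergence (hVl : LocallyIntegrable V volume)
    (hdiv : ∀ θ : EuclideanSpace ℝ (Fin 3) → ℝ, IsTestFunctionOn (⊤ : Opens (EuclideanSpace ℝ (Fin 3))) θ →
      ∫ y, ⟪selfSimilarTransport γ 0 V y, gradient θ y⟫ = -(3 * γ) * ∫ y, θ y) :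
    IsWeaklyDivFree V := by
  intro θ hθ
  have h1 := hdiv θ hθ
  -- the dilation identity `∫ Dθ[y] = −3∫θ` (weak derivative of the constant `1`)
  have hconst : HasWeakFDerivOn (⊤ : Opens (EuclideanSpace ℝ (Fin 3))) volume (fun _ : EuclideanSpace ℝ (Fin 3) => (1 : ℝ))
      (fun _ => (0 : EuclideanSpace ℝ (Fin 3) →L[ℝ] ℝ)) := by
    have h := HasWeakFDerivOn.of_contDiff_holds (⊤ : Opens (EuclideanSpace ℝ (Fin 3))) (volume : Measure (EuclideanSpace ℝ (Fin 3)))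
      (f := fun _ : EuclideanSpace ℝ (Fin 3) => (1 : ℝ)) contDiff_const
    have e0 : (fderiv ℝ fun _ : EuclideanSpace ℝ (Fin 3) => (1 : ℝ)) = fun _ => (0 : EuclideanSpace ℝ (Fin 3) →L[ℝ] ℝ) := by
      funext x; exact fderiv_const_apply _
    rw [e0] at h
    exact h
  have hdil := WeakRenormalized.integral_mul_fderiv_apply_id hconst hθ
  simp only [one_mul, mul_one, _root_.zero_apply, mul_zero, integral_zero, sub_zero] at hdil
  -- split `W = γ(y − 0) + V`
  have hIy : Integrable (fun y => fderiv ℝ θ y y) volume :=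
    (((hθ.contDiff.continuous_fderiv (by simp)).clm_apply continuous_id)).integrable_of_hasCompactSupport
      ((hθ.hasCompactSupport.fderiv (𝕜 := ℝ)).mono fun y hy => by
        rw [mem_support] at hy ⊢; intro h; exact hy (by rw [h, _root_.zero_apply]))
  have hIV : Integrable (fun y => fderiv ℝ θ y (V y)) volume :=
    WeakEulerian.integrable_clm_apply_of_locallyIntegrable (hθ.contDiff.continuous_fderiv (by simp))
      (hθ.hasCompactSupport.fderiv (𝕜 := ℝ)) hVl
  simp_rw [inner_gradient_eq_fderiv_apply, selfSimilarTransport_apply, sub_zero, map_add, map_smul, smul_eq_mul] at h1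
  have hIy' : Integrable (fun y => γ * fderiv ℝ θ y y) volume := hIy.const_mul γ
  rw [integral_add hIy' hIV, integral_const_mul, hdil] at h1
  simp_rw [inner_gradient_eq_fderiv_apply]
  have h2 : ∫ y, fderiv ℝ θ y (V y) = -(3 * γ) * (∫ y, θ y) - γ * (-3 * ∫ y, θ y) := by rw [← h1]; ring
  rw [h2]; ring

/-- **The commutator limit under the DiPerna–Lions lemma**: `tr(γ·id + G) = 3γ` a.e. (`V` weakly divergence free), so `φ̃ₙ ⋆ (η·tr DW) = 3γ·(φ̃ₙ ⋆ η)`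
and `rₙ + 3γη = sₙ + 3γ(η − φ̃ₙ ⋆ η) → 0` in `L¹(B_R)`. [folklore] -/
theorem commutator_limit_of_DL (hDL : DiPernaLionsCommutatorL2)
    (hVG : HasWeakFDerivOn (⊤ : Opens (EuclideanSpace ℝ (Fin 3))) volume V G)
    (hG2 : ∀ r : ℝ, MemLp G 2 (volume.restrict (ball (0 : EuclideanSpace ℝ (Fin 3)) r)))
    (hV6 : ∀ r : ℝ, MemLp V 6 (volume.restrict (ball (0 : EuclideanSpace ℝ (Fin 3)) r)))
    (hWG : HasWeakFDerivOn (⊤ : Opens (EuclideanSpace ℝ (Fin 3))) volume (selfSimilarTransport γ 0 V)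
      (fun x => γ • ContinuousLinearMap.id ℝ (EuclideanSpace ℝ (Fin 3)) + G x))
    (hdiv : ∀ θ : EuclideanSpace ℝ (Fin 3) → ℝ, IsTestFunctionOn (⊤ : Opens (EuclideanSpace ℝ (Fin 3))) θ →
      ∫ y, ⟪selfSimilarTransport γ 0 V y, gradient θ y⟫ = -(3 * γ) * ∫ y, θ y)
    (hη2 : ∀ r : ℝ, MemLp η 2 (volume.restrict (ball (0 : EuclideanSpace ℝ (Fin 3)) r)))
    {φ : ℕ → ContDiffBump (0 : EuclideanSpace ℝ (Fin 3))} (hφ : Tendsto (fun n => (φ n).rOut) atTop (𝓝 0))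
    (hφ2 : ∀ n, (φ n).rOut = 2 * (φ n).rIn) (R : ℝ) :
    Tendsto (fun n => ∫⁻ x in ball (0 : EuclideanSpace ℝ (Fin 3)) R,
      ‖(∫ y, η y * fderiv ℝ ((φ n).normed volume) (x - y) (selfSimilarTransport γ 0 V x - selfSimilarTransport γ 0 V y)) + 3 * γ * η x‖ₑ)
      atTop (𝓝 0) := by
  obtain ⟨W, hW⟩ : ∃ W : EuclideanSpace ℝ (Fin 3) → EuclideanSpace ℝ (Fin 3), W = selfSimilarTransport γ 0 V := ⟨_, rfl⟩
  obtain ⟨DW, hDW⟩ : ∃ DW : EuclideanSpace ℝ (Fin 3) → EuclideanSpace ℝ (Fin 3) →L[ℝ] EuclideanSpace ℝ (Fin 3),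
      DW = fun x => γ • ContinuousLinearMap.id ℝ (EuclideanSpace ℝ (Fin 3)) + G x := ⟨_, rfl⟩
  rw [← hDW, ← hW] at hWG
  rw [← hW]
  obtain ⟨B, hB⟩ : ∃ B : Set (EuclideanSpace ℝ (Fin 3)), B = ball (0 : EuclideanSpace ℝ (Fin 3)) R := ⟨_, rfl⟩
  rw [← hB]
  haveI : IsFiniteMeasure ((volume : Measure (EuclideanSpace ℝ (Fin 3))).restrict B) := by
    rw [hB]; exact isFiniteMeasure_restrict.2 measure_ball_lt_top.ne
  have hVl : LocallyIntegrable V volume := locallyIntegrableOn_univ.1 (by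
    simpa only [Opens.coe_top] using hVG.locallyIntegrableOn)
  have hV2 : ∀ r : ℝ, MemLp V 2 (volume.restrict (ball (0 : EuclideanSpace ℝ (Fin 3)) r)) := fun r => by
    haveI : IsFiniteMeasure ((volume : Measure (EuclideanSpace ℝ (Fin 3))).restrict (ball (0 : EuclideanSpace ℝ (Fin 3)) r)) :=
      isFiniteMeasure_restrict.2 measure_ball_lt_top.ne
    exact (hV6 r).mono_exponent (by norm_num)
  have hW2 : ∀ r : ℝ, MemLp W 2 (volume.restrict (ball (0 : EuclideanSpace ℝ (Fin 3)) r)) := fun r => by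
    rw [hW]
    exact (memLp_drift_ball γ r).add (hV2 r)
  have hGm : AEStronglyMeasurable G volume := (locallyIntegrableOn_univ.1 (by
    simpa only [Opens.coe_top] using hVG.locallyIntegrableOn_deriv)).aestronglyMeasurable
  have hDWm : AEStronglyMeasurable DW volume := by
    rw [hDW]; exact aestronglyMeasurable_const.add hGm
  have hDW2 : ∀ r : ℝ, MemLp DW 2 (volume.restrict (ball (0 : EuclideanSpace ℝ (Fin 3)) r)) := fun r => by
    haveI : IsFiniteMeasure ((volume : Measure (EuclideanSpace ℝ (Fin 3))).restrict (ball (0 : EuclideanSpace ℝ (Fin 3)) r)) :=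
      isFiniteMeasure_restrict.2 measure_ball_lt_top.ne
    have href : MemLp (fun x => (1 : ℝ) + ‖G x‖) 2 (volume.restrict (ball (0 : EuclideanSpace ℝ (Fin 3)) r)) :=
      (memLp_const (1 : ℝ)).add (hG2 r).norm
    refine MemLp.of_le_mul (c := max ‖γ • ContinuousLinearMap.id ℝ (EuclideanSpace ℝ (Fin 3))‖ 1) href hDWm.restrict
      (Eventually.of_forall fun x => ?_)
    have hn : ‖(1 : ℝ) + ‖G x‖‖ = 1 + ‖G x‖ := by rw [Real.norm_eq_abs]; exact abs_of_nonneg (by positivity)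
    rw [hn, hDW]
    calc ‖γ • ContinuousLinearMap.id ℝ (EuclideanSpace ℝ (Fin 3)) + G x‖ ≤ ‖γ • ContinuousLinearMap.id ℝ (EuclideanSpace ℝ (Fin 3))‖ + ‖G x‖ :=
          norm_add_le _ _
      _ ≤ max ‖γ • ContinuousLinearMap.id ℝ (EuclideanSpace ℝ (Fin 3))‖ 1 * 1 + max ‖γ • ContinuousLinearMap.id ℝ (EuclideanSpace ℝ (Fin 3))‖ 1 * ‖G x‖ := by
          refine add_le_add (by rw [mul_one]; exact le_max_left _ _) ?_
          exact le_mul_of_one_le_left (norm_nonneg _) (le_max_right _ _)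
      _ = max ‖γ • ContinuousLinearMap.id ℝ (EuclideanSpace ℝ (Fin 3))‖ 1 * (1 + ‖G x‖) := by ring
  -- ### `tr DW = 3γ` a.e.
  have hdivV : IsWeaklyDivFree V := isWeaklyDivFree_of_transportDivergence hVl hdiv
  have htr : ∀ᵐ x ∂(volume : Measure (EuclideanSpace ℝ (Fin 3))),
      LinearMap.trace ℝ (EuclideanSpace ℝ (Fin 3)) (DW x : EuclideanSpace ℝ (Fin 3) →ₗ[ℝ] EuclideanSpace ℝ (Fin 3)) = 3 * γ := by
    filter_upwards [hdivV.trace_weakGradient_ae_eq_zero hVG] with x hx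
    rw [hDW]
    rw [ContinuousLinearMap.toLinearMap_add, map_add, ContinuousLinearMap.toLinearMap_smul, map_smul, hx, add_zero, ContinuousLinearMap.coe_id,
      LinearMap.trace_id, finrank_euclideanSpace, Fintype.card_fin, smul_eq_mul]
    push_cast
    ring
  -- ### the fact, and the identification `φ̃ₙ ⋆ (η tr DW) = 3γ ηₙ`
  have hfact := hDL W DW η hWG hW2 hDW2 hη2 φ hφ hφ2 R
  rw [← hB] at hfact
  have hconv : ∀ n x, ((φ n).normed volume ⋆[lsmul ℝ ℝ, volume] fun y => η y * LinearMap.trace ℝ (EuclideanSpace ℝ (Fin 3))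
      (DW y : EuclideanSpace ℝ (Fin 3) →ₗ[ℝ] EuclideanSpace ℝ (Fin 3))) x =
      3 * γ * ((φ n).normed volume ⋆[lsmul ℝ ℝ, volume] η) x := by
    intro n x
    rw [convolution_lsmul_eq_integral, convolution_lsmul_eq_integral, ← integral_const_mul]
    refine integral_congr_ae ?_
    have hshift : ∀ᵐ y ∂(volume : Measure (EuclideanSpace ℝ (Fin 3))),
        LinearMap.trace ℝ (EuclideanSpace ℝ (Fin 3)) (DW y : EuclideanSpace ℝ (Fin 3) →ₗ[ℝ] EuclideanSpace ℝ (Fin 3)) = 3 * γ := htr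
    filter_upwards [hshift] with y hy
    rw [hy]; ring
  -- ### `ηₙ → η` in `L¹(B)`
  set ηn : ℕ → EuclideanSpace ℝ (Fin 3) → ℝ := fun n => (φ n).normed volume ⋆[lsmul ℝ ℝ, volume] η with hηn
  have hηl : LocallyIntegrable η volume := locallyIntegrable_of_memLp_two_ball hη2
  have hηm : AEStronglyMeasurable η volume := hηl.aestronglyMeasurable
  have hηnm : ∀ n, AEStronglyMeasurable (ηn n) volume := fun n => (contDiff_normed_convolution (φ n) hηl (n := 1)).continuous.aestronglyMeasurable
  have hL2 : Tendsto (fun n => ∫⁻ z in B, ‖ηn n z - η z‖ₑ ^ (2 : ℝ)) atTop (𝓝 0) := by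
    rw [hB]; exact tendsto_setLIntegral_mollify_sub_sq hφ hη2 R
  have hL1 : Tendsto (fun n => ∫⁻ z in B, ‖ηn n z - η z‖ₑ) atTop (𝓝 0) := by
    have hvol : (∫⁻ _z in B, (1 : ℝ≥0∞)) ^ (1 / (2 : ℝ)) ≠ ⊤ := by
      rw [setLIntegral_one, hB]; exact (ENNReal.rpow_lt_top_of_nonneg (by norm_num) measure_ball_lt_top.ne).ne
    have hbound : ∀ n, ∫⁻ z in B, ‖ηn n z - η z‖ₑ ≤
        (∫⁻ z in B, ‖ηn n z - η z‖ₑ ^ (2 : ℝ)) ^ (1 / (2 : ℝ)) * (∫⁻ _z in B, (1 : ℝ≥0∞)) ^ (1 / (2 : ℝ)) := by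
      intro n
      have h := lintegral_enorm_mul_le_sqrt (s := B) ((hηnm n).sub hηm).restrict (aestronglyMeasurable_const (b := (1 : ℝ)))
      simp only [enorm_one, mul_one, ENNReal.one_rpow] at h
      exact h
    have hlim : Tendsto (fun n => (∫⁻ z in B, ‖ηn n z - η z‖ₑ ^ (2 : ℝ)) ^ (1 / (2 : ℝ)) * (∫⁻ _z in B, (1 : ℝ≥0∞)) ^ (1 / (2 : ℝ)))
        atTop (𝓝 0) := by
      have h0 : (0 : ℝ≥0∞) ^ (1 / (2 : ℝ)) = 0 := ENNReal.zero_rpow_of_pos (by norm_num)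
      have hs : Tendsto (fun n => (∫⁻ z in B, ‖ηn n z - η z‖ₑ ^ (2 : ℝ)) ^ (1 / (2 : ℝ))) atTop (𝓝 0) := by
        rw [← h0]; exact (ENNReal.continuous_rpow_const.tendsto 0).comp hL2
      have h := ENNReal.Tendsto.mul_const hs (Or.inr hvol)
      rwa [zero_mul] at h
    exact tendsto_of_tendsto_of_tendsto_of_le_of_le tendsto_const_nhds hlim (fun _ => bot_le) hbound
  -- ### `rₙ + 3γη = sₙ + 3γ(η − ηₙ)`
  have hbound : ∀ n, ∫⁻ x in B, ‖(∫ y, η y * fderiv ℝ ((φ n).normed volume) (x - y) (W x - W y)) + 3 * γ * η x‖ₑ ≤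
      (∫⁻ x in B, ‖(∫ y, η y * fderiv ℝ ((φ n).normed volume) (x - y) (W x - W y)) +
        ((φ n).normed volume ⋆[lsmul ℝ ℝ, volume] fun y => η y * LinearMap.trace ℝ (EuclideanSpace ℝ (Fin 3))
          (DW y : EuclideanSpace ℝ (Fin 3) →ₗ[ℝ] EuclideanSpace ℝ (Fin 3))) x‖ₑ) +
      ENNReal.ofReal (3 * |γ|) * ∫⁻ x in B, ‖ηn n x - η x‖ₑ := by
    intro n
    have hmeas : AEMeasurable (fun x => ENNReal.ofReal (3 * |γ|) * ‖ηn n x - η x‖ₑ) (volume.restrict B) :=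
      (((hηnm n).sub hηm).restrict.enorm.const_mul _)
    have hpt : ∀ x, ‖(∫ y, η y * fderiv ℝ ((φ n).normed volume) (x - y) (W x - W y)) + 3 * γ * η x‖ₑ ≤
        ‖(∫ y, η y * fderiv ℝ ((φ n).normed volume) (x - y) (W x - W y)) +
          ((φ n).normed volume ⋆[lsmul ℝ ℝ, volume] fun y => η y * LinearMap.trace ℝ (EuclideanSpace ℝ (Fin 3))
            (DW y : EuclideanSpace ℝ (Fin 3) →ₗ[ℝ] EuclideanSpace ℝ (Fin 3))) x‖ₑ + ENNReal.ofReal (3 * |γ|) * ‖ηn n x - η x‖ₑ := by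
      intro x
      rw [hconv n x]
      have e : (∫ y, η y * fderiv ℝ ((φ n).normed volume) (x - y) (W x - W y)) + 3 * γ * η x =
          ((∫ y, η y * fderiv ℝ ((φ n).normed volume) (x - y) (W x - W y)) + 3 * γ * ηn n x) + (3 * γ) * (η x - ηn n x) := by
        rw [hηn]; ring
      rw [e]
      refine (enorm_add_le _ _).trans (add_le_add le_rfl ?_)
      rw [← ofReal_norm, ← ofReal_norm, ← ENNReal.ofReal_mul (by positivity), norm_mul, Real.norm_eq_abs, Real.norm_eq_abs, Real.norm_eq_abs,
        abs_mul, abs_of_pos (by norm_num : (0 : ℝ) < 3), abs_sub_comm]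
    calc ∫⁻ x in B, ‖(∫ y, η y * fderiv ℝ ((φ n).normed volume) (x - y) (W x - W y)) + 3 * γ * η x‖ₑ
        ≤ ∫⁻ x in B, (‖(∫ y, η y * fderiv ℝ ((φ n).normed volume) (x - y) (W x - W y)) +
            ((φ n).normed volume ⋆[lsmul ℝ ℝ, volume] fun y => η y * LinearMap.trace ℝ (EuclideanSpace ℝ (Fin 3))
              (DW y : EuclideanSpace ℝ (Fin 3) →ₗ[ℝ] EuclideanSpace ℝ (Fin 3))) x‖ₑ + ENNReal.ofReal (3 * |γ|) * ‖ηn n x - η x‖ₑ) :=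
          lintegral_mono fun x => hpt x
      _ = _ := by rw [lintegral_add_right' _ hmeas, lintegral_const_mul' _ _ ENNReal.ofReal_ne_top]
  have hlim : Tendsto (fun n => (∫⁻ x in B, ‖(∫ y, η y * fderiv ℝ ((φ n).normed volume) (x - y) (W x - W y)) +
        ((φ n).normed volume ⋆[lsmul ℝ ℝ, volume] fun y => η y * LinearMap.trace ℝ (EuclideanSpace ℝ (Fin 3))
          (DW y : EuclideanSpace ℝ (Fin 3) →ₗ[ℝ] EuclideanSpace ℝ (Fin 3))) x‖ₑ) +
      ENNReal.ofReal (3 * |γ|) * ∫⁻ x in B, ‖ηn n x - η x‖ₑ) atTop (𝓝 0) := by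
    have h2 := ENNReal.Tendsto.const_mul (a := ENNReal.ofReal (3 * |γ|)) hL1 (Or.inr ENNReal.ofReal_ne_top)
    rw [mul_zero] at h2
    simpa using hfact.add h2
  exact tendsto_of_tendsto_of_tendsto_of_le_of_le tendsto_const_nhds hlim (fun _ => bot_le) hbound

/-- **`stub_etaRenormalisation` (X1b) of `Lines/weak_axisym.lean`, CLOSED MODULO THE DIPERNA–LIONS COMMUTATOR LEMMA**, with `IsProfileGradient`,
`HasTransportDivergence`, `SolvesThetaTransport`, `HasRenormalisedEta`, `transportW` δ-unfolded and the Casimir generalised to an arbitrary scalar `η`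
(fill, with the fact `hDL : Literature.Analysis.FunctionSpaces.DiPernaLionsCommutatorL2` as a hypothesis: `intro ρ hρ hρh V G hG hdiv hη2 hθ; exact WeakAxisym.etaRenormalisation hDL hρ hρh hG hdiv hη2 hθ`, `η := etaOf G`):
an `L²_loc` distributional solution `η` of the damped Casimir law `div(Wη) = (2γ−1)η`, `W = γy + V ∈ W^{1,2}_loc`, `div W = 3γ`, is renormalised.
CONDITIONAL on the named fact `DiPernaLionsCommutatorL2` (DiPerna–Lions 1989, Lemma II.1); everything else is proved (`hasRenormalisedEta_of_commutator`).
[folklore; DiPernaLions1989Invent Thm. II.1 (proof)] -/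
theorem etaRenormalisation (hDL : DiPernaLionsCommutatorL2) {ρ : ℝ} (_hρ : 0 < ρ) (_hρh : ρ ≤ 1 / 2)
    {V : EuclideanSpace ℝ (Fin 3) → EuclideanSpace ℝ (Fin 3)} {G : EuclideanSpace ℝ (Fin 3) → EuclideanSpace ℝ (Fin 3) →L[ℝ] EuclideanSpace ℝ (Fin 3)}
    {η : EuclideanSpace ℝ (Fin 3) → ℝ}
    (hPG : HasWeakFDerivOn (⊤ : Opens (EuclideanSpace ℝ (Fin 3))) volume V G ∧
      (∀ r : ℝ, MemLp G 2 (volume.restrict (ball (0 : EuclideanSpace ℝ (Fin 3)) r))) ∧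
      (∀ r : ℝ, MemLp V 6 (volume.restrict (ball (0 : EuclideanSpace ℝ (Fin 3)) r))) ∧
      HasWeakFDerivOn (⊤ : Opens (EuclideanSpace ℝ (Fin 3))) volume (selfSimilarTransport (1 / (2 + ρ)) 0 V)
        (fun x => (1 / (2 + ρ)) • ContinuousLinearMap.id ℝ (EuclideanSpace ℝ (Fin 3)) + G x))
    (hdiv : ∀ φ : EuclideanSpace ℝ (Fin 3) → ℝ, IsTestFunctionOn (⊤ : Opens (EuclideanSpace ℝ (Fin 3))) φ →
      ∫ y, ⟪selfSimilarTransport (1 / (2 + ρ)) 0 V y, gradient φ y⟫ = -(3 * (1 / (2 + ρ))) * ∫ y, φ y)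
    (hη2 : ∀ r : ℝ, MemLp η 2 (volume.restrict (ball (0 : EuclideanSpace ℝ (Fin 3)) r)))
    (hθ : ∀ ψ : EuclideanSpace ℝ (Fin 3) → ℝ, IsTestFunctionOn (⊤ : Opens (EuclideanSpace ℝ (Fin 3))) ψ →
      ∫ y, η y * fderiv ℝ ψ y (selfSimilarTransport (1 / (2 + ρ)) 0 V y) = (1 - 2 * (1 / (2 + ρ))) * ∫ y, η y * ψ y) :
    ∀ β : ℝ → ℝ, ContDiff ℝ 1 β → (∃ C : ℝ, ∀ s : ℝ, ‖deriv β s‖ ≤ C) →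
      ∀ ψ : EuclideanSpace ℝ (Fin 3) → ℝ, IsTestFunctionOn (⊤ : Opens (EuclideanSpace ℝ (Fin 3))) ψ →
        ∫ y, β (η y) * (3 * (1 / (2 + ρ)) * ψ y + fderiv ℝ ψ y (selfSimilarTransport (1 / (2 + ρ)) 0 V y)) =
          ∫ y, ψ y * ((1 + 1 / (2 + ρ)) * η y * deriv β (η y)) := by
  intro β hβ hβ' ψ hψ
  obtain ⟨hVG, hG2, hV6, hWG⟩ := hPG
  -- a fixed-shape mollifier sequence: `rIn = 1/(2(n+1))`, `rOut = 1/(n+1) = 2 rIn`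
  set φ : ℕ → ContDiffBump (0 : EuclideanSpace ℝ (Fin 3)) := fun n =>
    ⟨1 / (2 * ((n : ℝ) + 1)), 1 / ((n : ℝ) + 1), by positivity, by
      rw [one_div_lt_one_div (by positivity) (by positivity)]; linarith⟩ with hφdef
  have hφ : Tendsto (fun n => (φ n).rOut) atTop (𝓝 0) := tendsto_one_div_add_atTop_nhds_zero_nat
  have hφ2 : ∀ n, (φ n).rOut = 2 * (φ n).rIn := fun n => by
    change 1 / ((n : ℝ) + 1) = 2 * (1 / (2 * ((n : ℝ) + 1)))
    field_simp
  have hφ' : ∀ n, (φ n).rOut ≤ 2 * (φ n).rIn := fun n => (hφ2 n).le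
  have hVl : LocallyIntegrable V volume := locallyIntegrableOn_univ.1 (by
    simpa only [Opens.coe_top] using hVG.locallyIntegrableOn)
  have hWl : LocallyIntegrable (selfSimilarTransport (1 / (2 + ρ)) 0 V) volume := by
    have h1 : LocallyIntegrable (fun y : EuclideanSpace ℝ (Fin 3) => (1 / (2 + ρ)) • (y - 0)) volume :=
      ((continuous_id.sub continuous_const).const_smul (1 / (2 + ρ))).locallyIntegrable
    exact h1.add hVl
  have hV2 : ∀ r : ℝ, MemLp V 2 (volume.restrict (ball (0 : EuclideanSpace ℝ (Fin 3)) r)) := fun r => by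
    haveI : IsFiniteMeasure ((volume : Measure (EuclideanSpace ℝ (Fin 3))).restrict (ball (0 : EuclideanSpace ℝ (Fin 3)) r)) :=
      isFiniteMeasure_restrict.2 measure_ball_lt_top.ne
    exact (hV6 r).mono_exponent (by norm_num)
  have hW2 : ∀ r : ℝ, MemLp (selfSimilarTransport (1 / (2 + ρ)) 0 V) 2 (volume.restrict (ball (0 : EuclideanSpace ℝ (Fin 3)) r)) :=
    fun r => (memLp_drift_ball (1 / (2 + ρ)) r).add (hV2 r)
  have hcomm := commutator_limit_of_DL hDL hVG hG2 hV6 hWG hdiv hη2 hφ hφ2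
  exact hasRenormalisedEta_of_commutator hWl hW2 hdiv hη2 hθ hφ hφ' hcomm hβ hβ' hψ

end Summit.NavierStokesRegularity.NavierStokesRegularity.Theorems.PowerGaugeEulerLiouville.WeakAxisym

end
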